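import Summits.CriticalPhenomena.PercolationContinuityZ3.Theorems.Transplant.SkelPhiSeedSlab
import HarnessLib

/-!
# N1 (the `{±1}` node), LEVEL 1, kit adapter file N-K3: THE APRON — a wired, internally connected, bounded region of the BASE chart hugging a
# slanted line, built from straight `φ`-walks and fat prisms (`Skelφ.walk`, `Skelφ.cylBall`), for a bare planar map `φ : V → ℤ²` with `Steps`
# (columns) and, for the capture lemma, `Frames` + `CylConn` ((κ))

builds on p205010 (kernel theorem, internal audit signed; external expert review pending) — nothing in this file uses p205010; nothing here is a
claim about the open node `SamePDropOfSkeletonNeg`.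
Lane `prim-bschramm`, seat `prim-bschramm-p1` (gen 11; kit-layer of the N1 chains, design note KIT-APRON-N1 / lane INBOX 2026-08-21 13:56Z); helper file
(`--supports stmt-CriticalPhenomena-4575 --as helper`).
WHY.  The D″ kit wires the fat prism `cylBall t ℓs R′` (an axis-aligned `φ`-box about the deep centre) against a face ROW; in N1 the window levels are
floors of a SHEARED form, the pinned shell is bounded by a SLANTED line of the base chart, and the wired body of a contact must hug that line from
below while staying internally connected and of `p`-fixed size.  The APRON about a base vertex `t` (exit axis `a`, sign `s`, tangential axis
`b = oth a`, width `W`, height profile `K`, thickness `ℓ`, radius `R′`):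
  planar points `φ t + m e_b + k s e_a` (`|m| ≤ W`, `0 ≤ k ≤ K m`), vertices `apronCol m k := walk_a^k (walk_b^m t)` (exact planar tracks),
  wired set `apronFin := ⋃_{m,k} cylBallFin (apronCol m k) ℓ R′`.
It is L-convex from `φ t` by construction, hence `PathIn`-connected from `t` with no planar topology (§3); its footprint, graph radius and size are
explicit (§2); and (κ) + frames put every vertex `w` that is graph-near a column vertex and `φ`-within `ℓ` of it INTO the apron (§4, the capture
lemma used for the outside-neighbours of the shell's exit vertices).
* §1 `apronBase`, `apronCol`, `apronPt`, `φ_apronBase`, `φ_apronCol`, `apronBase/apronCol_mem_graphBall`;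
* §2 **`apronFin`**, `apronCol_mem_apronFin`, `self_mem_apronFin`, `exists_of_mem_apronFin` (footprint), `apronFin_subset_graphBall`, `card_apronFin_le`;
* §3 **`pathIn_apronFin`**; §4 **`mem_apronFin_of_near`** (capture, from `graphBall_inter_cyl_subset_cylBall'`).
[cite: KozmaNitzan2024, §4 Lemma 10, p. 19 (the wired cube), p. 21 (v(P) + Λ_M), p. 26 ((29): columns)] [cite: GrimmettPercolation1999, §1.6]
-/

noncomputable section

open scoped Classical

namespace Summit.CriticalPhenomena.PercolationContinuityZ3.Theorems.Transplant

namespace Skelφ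

open Literature.Probability.Percolation Literature.Probability.LatticeModels SimpleGraph
open Literature.Probability.Percolation.KozmaNitzan.Cells (oth oth_ne eq_oth_of_ne oth_oth)
open Literature.Barriers.CriticalPhenomena (graphBall graphBall_finite mem_graphBall_self graphBall_mono)

variable {V : Type} (G : SimpleGraph V) (φ : V → Site 2)

/-! ## §1 Column vertices of the apron -/

/-- **The tangential base** `m` steps from `t` along `e_b`, `b = oth a` (sign of `m`). [folklore] -/
def apronBase (t : V) (a : Fin 2) (m : ℤ) : V :=
  if 0 ≤ m then walk G φ (oth a) 1 t m.natAbs else walk G φ (oth a) (-1) t m.natAbs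

/-- **The column vertex** `(m, k)`: `k` steps along `s e_a` from the tangential base `m`. [folklore] -/
def apronCol (t : V) (a : Fin 2) (s : ℤˣ) (m : ℤ) (k : ℕ) : V :=
  walk G φ a s (apronBase G φ t a m) k

/-- The planar point `(m, k)` of the apron about `z`: `z + m e_b + k s e_a`. [folklore] -/
def apronPt (z : Site 2) (a : Fin 2) (s : ℤˣ) (m : ℤ) (k : ℕ) : Site 2 :=
  z + Pi.single (oth a) m + Pi.single a ((k : ℤ) * (s : ℤ))

variable {G φ}

/-- Planar position of the tangential base: `φ t + m e_b` (under `Steps`). [folklore] -/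
theorem φ_apronBase (hstep : Steps G φ) (t : V) (a : Fin 2) (m : ℤ) :
    φ (apronBase G φ t a m) = φ t + Pi.single (oth a) m := by
  unfold apronBase
  split_ifs with hm
  · rw [φ_walk hstep, Units.val_one, mul_one, Int.natAbs_of_nonneg hm]
  · rw [φ_walk hstep, Units.val_neg, Units.val_one, mul_neg, mul_one, Int.ofNat_natAbs_of_nonpos (le_of_lt (not_le.1 hm)), neg_neg]

/-- Planar position of the column vertex: `φ (apronCol m k) = apronPt (φ t) a s m k`. [folklore] -/
theorem φ_apronCol (hstep : Steps G φ) (t : V) (a : Fin 2) (s : ℤˣ) (m : ℤ) (k : ℕ) :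
    φ (apronCol G φ t a s m k) = apronPt (φ t) a s m k := by
  unfold apronCol apronPt
  rw [φ_walk hstep, φ_apronBase hstep]

/-- The tangential base lies in `B_G(t, |m|)`. [folklore] -/
theorem apronBase_mem_graphBall (hstep : Steps G φ) (t : V) (a : Fin 2) (m : ℤ) : apronBase G φ t a m ∈ graphBall G t m.natAbs := by
  unfold apronBase
  split_ifs
  · exact walk_mem_graphBall hstep _ _ _ _
  · exact walk_mem_graphBall hstep _ _ _ _

/-- The column vertex lies in `B_G(t, |m| + k)`. [folklore] -/
theorem apronCol_mem_graphBall (hstep : Steps G φ) (t : V) (a : Fin 2) (s : ℤˣ) (m : ℤ) (k : ℕ) :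
    apronCol G φ t a s m k ∈ graphBall G t (m.natAbs + k) :=
  BoxProdZ2.mem_graphBall_add G (apronBase_mem_graphBall hstep t a m) (walk_mem_graphBall hstep a s _ k)

/-- `apronCol m 0` is the tangential base. [folklore] -/
@[simp] theorem apronCol_zero (t : V) (a : Fin 2) (s : ℤˣ) (m : ℤ) : apronCol G φ t a s m 0 = apronBase G φ t a m := rfl

/-- `apronBase 0 = t`. [folklore] -/
@[simp] theorem apronBase_zero (t : V) (a : Fin 2) : apronBase G φ t a 0 = t := by
  unfold apronBase; simp [walk]

/-! ## §2 The apron: definition, footprint, radius, size -/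

section Fin

variable [G.LocallyFinite]

variable (G φ) in
/-- **The apron** about `t` (exit axis `a`, sign `s`, width `W`, height profile `K`, thickness `ℓ`, radius `R′`): the union of the fat prisms
`cylBallFin (apronCol m k) ℓ R′` over `|m| ≤ W`, `0 ≤ k ≤ K m`. [this work] -/
def apronFin (t : V) (a : Fin 2) (s : ℤˣ) (W : ℕ) (K : ℤ → ℕ) (ℓ R' : ℕ) : Finset V :=
  (Finset.Icc (-(W : ℤ)) W).biUnion fun m => (Finset.range (K m + 1)).biUnion fun k => cylBallFin G φ (apronCol G φ t a s m k) ℓ R'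

/-- Membership in the apron. [folklore] -/
theorem mem_apronFin {t : V} {a : Fin 2} {s : ℤˣ} {W : ℕ} {K : ℤ → ℕ} {ℓ R' : ℕ} {v : V} :
    v ∈ apronFin G φ t a s W K ℓ R' ↔ ∃ m : ℤ, -(W : ℤ) ≤ m ∧ m ≤ W ∧ ∃ k : ℕ, k ≤ K m ∧ v ∈ cylBall G φ (apronCol G φ t a s m k) ℓ R' := by
  unfold apronFin
  simp only [Finset.mem_biUnion, Finset.mem_Icc, Finset.mem_range, mem_cylBallFin]
  constructor
  · rintro ⟨m, ⟨h1, h2⟩, k, hk, hv⟩; exact ⟨m, h1, h2, k, by omega, hv⟩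
  · rintro ⟨m, h1, h2, k, hk, hv⟩; exact ⟨m, ⟨h1, h2⟩, k, by omega, hv⟩

/-- A fat prism of the apron lies in the apron. [folklore] -/
theorem cylBall_subset_apronFin {t : V} {a : Fin 2} {s : ℤˣ} {W : ℕ} {K : ℤ → ℕ} {ℓ R' : ℕ} {m : ℤ} (hm : m.natAbs ≤ W) {k : ℕ} (hk : k ≤ K m) :
    cylBall G φ (apronCol G φ t a s m k) ℓ R' ⊆ ↑(apronFin G φ t a s W K ℓ R') := fun v hv => by
  rw [Finset.mem_coe, mem_apronFin]
  exact ⟨m, by omega, by omega, k, hk, hv⟩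

/-- Column vertices lie in the apron. [folklore] -/
theorem apronCol_mem_apronFin {t : V} {a : Fin 2} {s : ℤˣ} {W : ℕ} {K : ℤ → ℕ} {ℓ R' : ℕ} {m : ℤ} (hm : m.natAbs ≤ W) {k : ℕ} (hk : k ≤ K m) :
    apronCol G φ t a s m k ∈ apronFin G φ t a s W K ℓ R' :=
  cylBall_subset_apronFin (ℓ := ℓ) (R' := R') hm hk (self_mem_cylBall G φ _ ℓ R')

/-- The base vertex lies in the apron. [folklore] -/
theorem self_mem_apronFin (t : V) (a : Fin 2) (s : ℤˣ) (W : ℕ) (K : ℤ → ℕ) (ℓ R' : ℕ) : t ∈ apronFin G φ t a s W K ℓ R' := by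
  have h := apronCol_mem_apronFin (G := G) (φ := φ) (t := t) (a := a) (s := s) (W := W) (K := K) (ℓ := ℓ) (R' := R') (m := 0) (by simp)
    (Nat.zero_le (K 0))
  simpa using h

/-- **Footprint of the apron**: a vertex of the apron is `φ`-within `ℓ` of some apron point `(m, k)`, `|m| ≤ W`, `k ≤ K m` (under `Steps`). [folklore] -/
theorem exists_of_mem_apronFin (hstep : Steps G φ) {t : V} {a : Fin 2} {s : ℤˣ} {W : ℕ} {K : ℤ → ℕ} {ℓ R' : ℕ} {v : V}
    (hv : v ∈ apronFin G φ t a s W K ℓ R') :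
    ∃ m : ℤ, -(W : ℤ) ≤ m ∧ m ≤ W ∧ ∃ k : ℕ, k ≤ K m ∧ φ v - apronPt (φ t) a s m k ∈ box 2 ℓ ∧
      v ∈ graphBall G (apronCol G φ t a s m k) R' := by
  obtain ⟨m, h1, h2, k, hk, hv⟩ := mem_apronFin.1 hv
  refine ⟨m, h1, h2, k, hk, ?_, (cylBall_subset_prism G φ _ ℓ R' hv).1⟩
  rw [← φ_apronCol hstep t a s m k, ← mem_cyl]
  exact cylBall_subset_cyl G φ _ ℓ R' hv

/-- **Graph radius of the apron**: `apronFin ⊆ B_G(t, W + Kmax + R′)` when `K ≤ Kmax` on `[−W, W]` (under `Steps`). [folklore] -/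
theorem apronFin_subset_graphBall (hstep : Steps G φ) {t : V} {a : Fin 2} {s : ℤˣ} {W : ℕ} {K : ℤ → ℕ} {ℓ R' Kmax : ℕ}
    (hK : ∀ m : ℤ, -(W : ℤ) ≤ m → m ≤ W → K m ≤ Kmax) :
    ∀ v ∈ apronFin G φ t a s W K ℓ R', v ∈ graphBall G t (W + Kmax + R') := by
  intro v hv
  obtain ⟨m, h1, h2, k, hk, hv⟩ := mem_apronFin.1 hv
  have h3 := BoxProdZ2.mem_graphBall_add G (apronCol_mem_graphBall hstep t a s m k) (cylBall_subset_prism G φ _ ℓ R' hv).1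
  have hKm := hK m h1 h2
  exact graphBall_mono G t (by omega) h3

/-- **Size of the apron** under a degree bound: `≤ (2W+1)(Kmax+1)(Δ+1)^{R′}`. [folklore] -/
theorem card_apronFin_le {Δ : ℕ} (hΔ : ∀ v, G.degree v ≤ Δ) {t : V} {a : Fin 2} {s : ℤˣ} {W : ℕ} {K : ℤ → ℕ} {ℓ R' Kmax : ℕ}
    (hK : ∀ m : ℤ, -(W : ℤ) ≤ m → m ≤ W → K m ≤ Kmax) :
    (apronFin G φ t a s W K ℓ R').card ≤ (2 * W + 1) * (Kmax + 1) * (Δ + 1) ^ R' := by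
  unfold apronFin
  refine Finset.card_biUnion_le.trans ?_
  have hcol : ∀ m ∈ Finset.Icc (-(W : ℤ)) W, ((Finset.range (K m + 1)).biUnion fun k => cylBallFin G φ (apronCol G φ t a s m k) ℓ R').card ≤
      (Kmax + 1) * (Δ + 1) ^ R' := by
    intro m hm
    rw [Finset.mem_Icc] at hm
    refine Finset.card_biUnion_le.trans ?_
    calc ∑ k ∈ Finset.range (K m + 1), (cylBallFin G φ (apronCol G φ t a s m k) ℓ R').card
        ≤ ∑ _k ∈ Finset.range (K m + 1), (Δ + 1) ^ R' := Finset.sum_le_sum fun k _ => card_cylBallFin_le hΔ _ ℓ R'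
      _ = (K m + 1) * (Δ + 1) ^ R' := by rw [Finset.sum_const, Finset.card_range, smul_eq_mul]
      _ ≤ (Kmax + 1) * (Δ + 1) ^ R' := Nat.mul_le_mul_right _ (by have := hK m hm.1 hm.2; omega)
  calc ∑ m ∈ Finset.Icc (-(W : ℤ)) W, ((Finset.range (K m + 1)).biUnion fun k => cylBallFin G φ (apronCol G φ t a s m k) ℓ R').card
      ≤ ∑ _m ∈ Finset.Icc (-(W : ℤ)) W, (Kmax + 1) * (Δ + 1) ^ R' := Finset.sum_le_sum hcol
    _ = (2 * W + 1) * ((Kmax + 1) * (Δ + 1) ^ R') := by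
        rw [Finset.sum_const, smul_eq_mul, Int.card_Icc]
        congr 1
        rw [show (W : ℤ) + 1 - -(W : ℤ) = ((2 * W + 1 : ℕ) : ℤ) by push_cast; ring, Int.toNat_natCast]
    _ = (2 * W + 1) * (Kmax + 1) * (Δ + 1) ^ R' := by ring

/-! ## §3 Internal connectivity: the apron is L-convex from its base vertex -/

omit [G.LocallyFinite] in
/-- The tangential bases `m′` between `0` and `m` are joined to `t` inside any set containing them all (under `Steps`). [folklore] -/
theorem pathIn_apronBase (hstep : Steps G φ) (t : V) (a : Fin 2) {A : Set V} (m : ℤ)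
    (hA : ∀ m' : ℤ, m'.natAbs ≤ m.natAbs → 0 ≤ m' * m → apronBase G φ t a m' ∈ A) : PathIn G A t (apronBase G φ t a m) := by
  -- walk along the sign of `m`
  rcases le_or_gt 0 m with hm | hm
  · have key : ∀ n : ℕ, n ≤ m.natAbs → PathIn G A t (walk G φ (oth a) 1 t n) := by
      intro n hn
      induction n with
      | zero => exact PathIn.refl (by have := hA 0 (by simp) (by simp); simpa using this)
      | succ n ih =>
        refine (ih (by omega)).tail (walk_adj hstep (oth a) 1 t n) ?_
        have h := hA (n + 1 : ℕ) (by simp; omega) (by positivity)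
        unfold apronBase at h
        rwa [if_pos (by positivity), Int.natAbs_natCast] at h
    have h := key m.natAbs le_rfl
    unfold apronBase; rwa [if_pos hm]
  · have key : ∀ n : ℕ, n ≤ m.natAbs → PathIn G A t (walk G φ (oth a) (-1) t n) := by
      intro n hn
      induction n with
      | zero => exact PathIn.refl (by have := hA 0 (by simp) (by simp); simpa using this)
      | succ n ih =>
        refine (ih (by omega)).tail (walk_adj hstep (oth a) (-1) t n) ?_
        have h := hA (-(n + 1 : ℕ)) (by simp; omega) (by
          have : (-(n + 1 : ℕ) : ℤ) * m = (n + 1 : ℕ) * (-m) := by ring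
          rw [this]; exact mul_nonneg (by positivity) (by omega))
        unfold apronBase at h
        rwa [if_neg (by push_cast; omega), Int.natAbs_neg, Int.natAbs_natCast] at h
    have h := key m.natAbs le_rfl
    unfold apronBase; rwa [if_neg (not_le.2 hm)]

/-- **The apron is `G`-connected from its base vertex inside itself** (under `Steps`). [cite: KozmaNitzan2024, §4 p. 19 (the wired cube)] -/
theorem pathIn_apronFin (hstep : Steps G φ) (t : V) (a : Fin 2) (s : ℤˣ) (W : ℕ) (K : ℤ → ℕ) (ℓ R' : ℕ) :
    ∀ v ∈ apronFin G φ t a s W K ℓ R', PathIn G (↑(apronFin G φ t a s W K ℓ R') : Set V) t v := by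
  intro v hv
  obtain ⟨m, h1, h2, k, hk, hv⟩ := mem_apronFin.1 hv
  have hmW : m.natAbs ≤ W := by omega
  -- `t` to the tangential base `m`
  have hbase : PathIn G (↑(apronFin G φ t a s W K ℓ R') : Set V) t (apronBase G φ t a m) := by
    refine pathIn_apronBase hstep t a m fun m' hm' _ => ?_
    rw [Finset.mem_coe, ← apronCol_zero (s := s)]
    exact apronCol_mem_apronFin (hm'.trans hmW) (Nat.zero_le _)
  -- up the column to `(m, k)`
  have hcol : ∀ k' : ℕ, k' ≤ K m → PathIn G (↑(apronFin G φ t a s W K ℓ R') : Set V) t (apronCol G φ t a s m k') := by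
    intro k' hk'
    induction k' with
    | zero => simpa using hbase
    | succ k' ih =>
      exact (ih (by omega)).tail (walk_adj hstep a s _ k') (by rw [Finset.mem_coe]; exact apronCol_mem_apronFin hmW hk')
  -- inside the fat prism
  exact (hcol k hk).trans ((pathIn_cylBall G φ hv).mono (cylBall_subset_apronFin hmW hk))

/-! ## §4 Capture: graph-near and `φ`-near vertices of a column vertex lie in the apron ((κ) + frames) -/

/-- **Capture lemma**: a vertex within graph distance `r` of the column vertex `(m, k)` and `φ`-within `ℓ` of it lies in the apron, as soon as
`R′ ≥ cylRadMax ℓ r` (`1 ≤ ℓ`; frames + (κ)). [cite: KozmaNitzan2024, §4 p. 20 ((22)–(23))] -/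
theorem mem_apronFin_of_near {types : Finset V} (hfr : Frames G φ types) (hκ : CylConn G φ types) {t : V} {a : Fin 2} {s : ℤˣ} {W : ℕ}
    {K : ℤ → ℕ} {ℓ R' r : ℕ} (hℓ : 1 ≤ ℓ) (hR' : cylRadMax G φ types ℓ r ≤ R') {m : ℤ} (hm : m.natAbs ≤ W) {k : ℕ} (hk : k ≤ K m) {w : V}
    (hw : w ∈ graphBall G (apronCol G φ t a s m k) r) (hφ : φ w - φ (apronCol G φ t a s m k) ∈ box 2 ℓ) :
    w ∈ apronFin G φ t a s W K ℓ R' := by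
  have h := graphBall_inter_cyl_subset_cylBall' hfr hκ (apronCol G φ t a s m k) hℓ r ⟨hw, (mem_cyl φ _ ℓ w).2 hφ⟩
  exact cylBall_subset_apronFin hm hk (cylBall_mono G φ _ le_rfl hR' h)

end Fin

end Skelφ

end Summit.CriticalPhenomena.PercolationContinuityZ3.Theorems.Transplant

end
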